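import Literature.NumberTheory.EllipticCurves.BinaryQuarticGeometricSieveProofs
import Mathlib.NumberTheory.Chebyshev
import Mathlib.Analysis.Complex.ExponentialBounds
import HarnessLib

/-!
# Square divisors `p² ∣ Δ(f)` with `M < p ≤ T` for binary quartic forms in a box:
# `#{f : p² ∣ Δ(f) for some prime M < p ≤ T} ≤ (6144T⁵ + 3(2T+1)⁵)/M + 441(2T+1)⁴ + 3(2T+1)⁴·π(T)`

`Proofs` companion (theorems only: no definitions, no named facts) of
`BinaryQuarticGeometricSieveProofs.lean` (strong divisibility: the geometric sieve at
`Y = {Δ = ∂Δ/∂e = 0}`) and `BinaryQuarticDiscriminantIntervalProofs.lean` (weak divisibility: at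
most `3(L/p² + 1)` values of `e` in an interval of length `L`). Source: M. Bhargava, A. Shankar,
*Binary quartic forms having bounded invariants, and the boundedness of the average rank of
elliptic curves*, Ann. of Math. (2) 181 (2015) 191–242; theorem numbers are those of the published
version (= `arXiv:1006.1002v3`), §2.6.

## The step of the source formalised here

Thm 2.13 of the source (the uniformity estimate
`lim_{X→∞} N(∪_{p>M} W_p(V); X)/X^{5/6} = O(1/log M)`, `W_p(V) = {f ∈ V_ℤ : p² ∣ Δ(f)}`) is
assembled there from Thm 2.18 (`W_p^{(1)}`, strong divisibility, via the geometric sieve) and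
Thm 2.20 (`W_p^{(2)}`, weak divisibility), the latter using an elementary count for `p < X^{1/6}`
("`#{R_X^{(ε)} ∩ W_p^{(2)}(V)} = O(max{X^{5/6}/p², X^{4/6}})` … `O(X^{1/6}/log X)` primes in the
range `[1, X^{1/6}]`") and [dodqf, Prop. 23] with Prop. 2.16 (Delone–Evertse) for `p ≥ X^{1/6}`.
This file proves, for boxes `[−T, T]⁵` (the lattice points of `𝓕^{(ε)}·R^{(i)}(X)` have
coefficients `O(X^{1/6})`), everything in this assembly that does not depend on [dodqf]:

* `card_filter_sq_dvd_disc_not_dvd_discDerivE_le` — one prime `p ≥ 5`: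
  `#{f ∈ B : p² ∣ Δ(f), p ∤ ∂Δ/∂e(f)} ≤ 3((2T+1)/p² + 1)(2T+1)⁴` (the displayed count of the proof
  of Thm 2.20, from `card_filter_Ico_sq_dvd_disc_le` per quadruple `(a,b,c,d)`);
* `card_filter_exists_prime_Ioc_sq_dvd_disc_not_dvd_discDerivE_le` — primes `M < p ≤ T`:
  `≤ 3(2T+1)⁵/M + 3(2T+1)⁴·π(T)` (`∑_{p>M} p⁻² ≤ 1/M` and at most `π(T)` primes);
* `card_filter_exists_prime_Ioc_sq_dvd_disc_le` — **all of `W_p`, primes `M < p ≤ T`**: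
  `#{f ∈ B : ∃ prime p ∈ (M, T], p² ∣ Δ(f)} ≤ (6144T⁵ + 3(2T+1)⁵)/M + 441(2T+1)⁴ + 3(2T+1)⁴·π(T)`
  for `T ≥ 3`, `M ≥ 4` (a form with `p² ∣ Δ` and `p ∣ ∂Δ/∂e` reduces into `Y(𝔽_p)` and is counted by
  the geometric sieve `card_filter_exists_prime_gt_dvd_disc_dvd_discDerivE_le`; otherwise it is
  weakly divisible);
* `card_filter_exists_prime_Ioc_sq_dvd_disc_le_chebyshev` — the same with Mathlib's Chebyshev bound
  `π(T) ≤ (log 4)·T/log √T + √T`, i.e. `O(T⁵/M + T⁵/log T)` = the shape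
  `O(X^{5/6}/M + X^{5/6}/log X)` of the proof of Thm 2.13 for the primes up to `X^{1/6}`.
* `card_filter_exists_prime_Ioc_sq_dvd_disc_le_explicit` — the fully explicit form
  `≤ 6873·T⁵/M + 674·T⁵/log T + 35964·T⁴·√T` (`T ≥ 3`, `M ≥ 4`).

What remains of Thm 2.13 beyond this file is exactly the range `p > X^{1/6}` of the weakly
divisible forms (Thm 2.19 = [dodqf, Prop. 23], transported by Thm 2.14 and Prop. 2.16).

## References

* M. Bhargava, A. Shankar, Ann. of Math. (2) 181 (2015) 191–242, §2.6, Thms 2.13, 2.18, 2.20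
  (published numbering = arXiv:1006.1002v3). [cite: BhargavaShankarAnnals2015, §2.6, Thms 2.13, 2.18, 2.20 (published numbering)]
* P. L. Chebyshev's bound `π(x) ≪ x/log x` (Mathlib `Chebyshev.pi_le_log4_mul_div`). [folklore]
-/

noncomputable section

open scoped Classical Nat.Prime
open Finset

namespace Literature.NumberTheory.EllipticCurves

namespace BinaryQuartic

/-! ## §1. Weak divisibility, one prime: `#{f ∈ B : p² ∣ Δ, p ∤ ∂Δ/∂e} ≤ 3((2T+1)/p² + 1)(2T+1)⁴` -/

/-- **`W_p^{(2)}` in a box, one prime** (Bhargava–Shankar 2015, proof of Thm 2.20: "there are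
`O(X^{4/6})` possibilities for a quadruple `(a₀,b₀,c₀,d₀)` … at most `3` choices for the residue of
`e₀ (mod p)` such that `p ∣ Δ`. Since `p ∤ ∂Δ/∂e`, each such residue modulo `p` has a unique lift
modulo `p²` such that `p² ∣ Δ`. Hence `#{R_X^{(ε)} ∩ W_p^{(2)}(V)} = O(max{X^{5/6}/p², X^{4/6}})`").
For a prime `p ≥ 5` and a finite set `B` of integral forms with coefficients in `[−T, T]`:
`#{f ∈ B : p² ∣ Δ(f), p ∤ ∂Δ/∂e(f)} ≤ 3((2T+1)/p² + 1)·(2T+1)⁴`, by the interval count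
`card_filter_Ico_sq_dvd_disc_le` of `BinaryQuarticDiscriminantIntervalProofs` per quadruple.
[cite: BhargavaShankarAnnals2015, §2.6, proof of Thm 2.20 (published numbering)] -/
theorem card_filter_sq_dvd_disc_not_dvd_discDerivE_le {T p : ℕ} (hp : p.Prime) (hp5 : 5 ≤ p)
    (B : Finset (BinaryQuartic ℤ))
    (hB : ∀ f ∈ B, |f.a| ≤ T ∧ |f.b| ≤ T ∧ |f.c| ≤ T ∧ |f.d| ≤ T ∧ |f.e| ≤ T) :
    (B.filter fun f => (p : ℤ) ^ 2 ∣ f.disc ∧ ¬ (p : ℤ) ∣ f.discDerivE).card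
      ≤ 3 * ((2 * T + 1) / p ^ 2 + 1) * (2 * T + 1) ^ 4 := by
  classical
  haveI := Fact.mk hp
  set I : Finset ℤ := Icc (-(T : ℤ)) T with hIdef
  set Box4 : Finset (Fin 4 → ℤ) := Fintype.piFinset fun _ : Fin 4 => I with hBox4def
  have hI : I.card = 2 * T + 1 := by rw [hIdef, Int.card_Icc]; omega
  have hBox4 : Box4.card = (2 * T + 1) ^ 4 := by
    rw [hBox4def, Fintype.card_piFinset, prod_const, hI, card_univ, Fintype.card_fin]
  set P : (Fin 4 → ℤ) × ℤ → Prop := fun x =>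
      (p : ℤ) ^ 2 ∣ (⟨x.1 0, x.1 1, x.1 2, x.1 3, x.2⟩ : BinaryQuartic ℤ).disc ∧
        ¬ (p : ℤ) ∣ (⟨x.1 0, x.1 1, x.1 2, x.1 3, x.2⟩ : BinaryQuartic ℤ).discDerivE with hPdef
  -- pass to coefficient vectors
  have h1 : (B.filter fun f => (p : ℤ) ^ 2 ∣ f.disc ∧ ¬ (p : ℤ) ∣ f.discDerivE).card
      ≤ ((Box4 ×ˢ I).filter P).card := by
    refine card_le_card_of_injOn (fun f => (![f.a, f.b, f.c, f.d], f.e)) (fun f hf => ?_)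
      (fun f _ g _ h => ?_)
    · simp only [coe_filter, Set.mem_setOf_eq] at hf ⊢
      obtain ⟨hfB, hbad⟩ := hf
      obtain ⟨ha, hb, hc, hd, he⟩ := hB f hfB
      refine ⟨?_, by simpa [hPdef] using hbad⟩
      simp only [mem_product, hBox4def, Fintype.mem_piFinset, hIdef, mem_Icc_neg_iff]
      refine ⟨fun i => ?_, he⟩
      fin_cases i <;> simpa
    · simp only [Prod.mk.injEq] at h
      obtain ⟨h1, h2⟩ := h
      have h0 := congrFun h1 0
      have h1' := congrFun h1 1
      have h2' := congrFun h1 2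
      have h3 := congrFun h1 3
      simp at h0 h1' h2' h3
      ext <;> assumption
  -- fibrewise count over the quadruples
  have h2 : ((Box4 ×ˢ I).filter P).card ≤ (2 * T + 1) ^ 4 * (3 * ((2 * T + 1) / p ^ 2 + 1)) := by
    calc _ = ∑ y ∈ Box4, (I.filter fun e => P (y, e)).card := by
          rw [card_filter, sum_product]
          exact sum_congr rfl fun y _ => (card_filter _ _).symm
      _ ≤ ∑ y ∈ Box4, 3 * ((2 * T + 1) / p ^ 2 + 1) := sum_le_sum fun y _ => by
          simp only [hPdef, hIdef, Icc_neg_eq_Ico]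
          exact card_filter_Ico_sq_dvd_disc_le hp5 (y 0) (y 1) (y 2) (y 3) _ _
      _ = (2 * T + 1) ^ 4 * (3 * ((2 * T + 1) / p ^ 2 + 1)) := by
          rw [sum_const, smul_eq_mul, hBox4]
  calc _ ≤ _ := h1
    _ ≤ _ := h2
    _ = 3 * ((2 * T + 1) / p ^ 2 + 1) * (2 * T + 1) ^ 4 := by ring

/-! ## §2. Weak divisibility, primes `M < p ≤ T` -/

/-- The primes in `(M, N]` number at most `π(N)`. [folklore] -/
theorem card_filter_prime_Ioc_le (M N : ℕ) : ((Ioc M N).filter Nat.Prime).card ≤ π N := by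
  rw [← Nat.primesLE_card_eq_primeCounting]
  refine card_le_card fun p hp => ?_
  simp only [mem_filter, mem_Ioc] at hp
  exact Nat.mem_primesLE.mpr ⟨hp.1.2, hp.2⟩

/-- **`∪_{M < p ≤ T} W_p^{(2)}` in a box** (Bhargava–Shankar 2015, proof of Thm 2.20, the range
`p < X^{1/6}`: "`#{R_X^{(ε)} ∩ W_p^{(2)}(V)} = O(max{X^{5/6}/p², X^{4/6}})` … there are
`O(X^{1/6}/log X)` primes in the range `[1, X^{1/6}]`"). For `M ≥ 4` and a finite set `B` of
integral forms with coefficients in `[−T, T]`: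
`#{f ∈ B : ∃ prime p, M < p ≤ T, p² ∣ Δ(f), p ∤ ∂Δ/∂e(f)} ≤ 3(2T+1)⁵/M + 3(2T+1)⁴·π(T)`.
[cite: BhargavaShankarAnnals2015, §2.6, proof of Thm 2.20 (published numbering)] -/
theorem card_filter_exists_prime_Ioc_sq_dvd_disc_not_dvd_discDerivE_le {T M : ℕ} (hM : 4 ≤ M)
    (B : Finset (BinaryQuartic ℤ))
    (hB : ∀ f ∈ B, |f.a| ≤ T ∧ |f.b| ≤ T ∧ |f.c| ≤ T ∧ |f.d| ≤ T ∧ |f.e| ≤ T) :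
    ((B.filter fun f => ∃ p : ℕ, p.Prime ∧ M < p ∧ p ≤ T ∧
        (p : ℤ) ^ 2 ∣ f.disc ∧ ¬ (p : ℤ) ∣ f.discDerivE).card : ℝ)
      ≤ 3 * (2 * (T : ℝ) + 1) ^ 5 / M + 3 * (2 * (T : ℝ) + 1) ^ 4 * π T := by
  classical
  set Prm : Finset ℕ := (Ioc M T).filter Nat.Prime with hPrm
  have hsub : (B.filter fun f => ∃ p : ℕ, p.Prime ∧ M < p ∧ p ≤ T ∧
        (p : ℤ) ^ 2 ∣ f.disc ∧ ¬ (p : ℤ) ∣ f.discDerivE)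
      ⊆ Prm.biUnion fun p => B.filter fun f => (p : ℤ) ^ 2 ∣ f.disc ∧ ¬ (p : ℤ) ∣ f.discDerivE := by
    intro f hf
    simp only [mem_filter] at hf
    obtain ⟨hfB, p, hp, hMp, hpT, h1, h2⟩ := hf
    simp only [mem_biUnion, mem_filter, hPrm, mem_Ioc]
    exact ⟨p, ⟨⟨hMp, hpT⟩, hp⟩, hfB, h1, h2⟩
  have hT1 : (1 : ℝ) ≤ 2 * (T : ℝ) + 1 := by
    have : (0 : ℝ) ≤ T := by positivity
    linarith
  calc _ ≤ ((Prm.biUnion fun p => B.filter fun f =>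
        (p : ℤ) ^ 2 ∣ f.disc ∧ ¬ (p : ℤ) ∣ f.discDerivE).card : ℝ) := by exact_mod_cast card_le_card hsub
    _ ≤ ((∑ p ∈ Prm, (B.filter fun f =>
        (p : ℤ) ^ 2 ∣ f.disc ∧ ¬ (p : ℤ) ∣ f.discDerivE).card : ℕ) : ℝ) := by
        exact_mod_cast card_biUnion_le
    _ ≤ ∑ p ∈ Prm, (3 * (2 * (T : ℝ) + 1) ^ 5 * (1 / (p : ℝ) ^ 2) + 3 * (2 * (T : ℝ) + 1) ^ 4) := by
        push_cast
        refine sum_le_sum fun p hp => ?_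
        simp only [hPrm, mem_filter, mem_Ioc] at hp
        obtain ⟨⟨hMp, hpT⟩, hpp⟩ := hp
        have hp5 : 5 ≤ p := by omega
        have hp0 : (0 : ℝ) < p := by exact_mod_cast hpp.pos
        have h1 := card_filter_sq_dvd_disc_not_dvd_discDerivE_le (T := T) hpp hp5 B hB
        have hdiv : (((2 * T + 1) / p ^ 2 : ℕ) : ℝ) ≤ ((2 * T + 1 : ℕ) : ℝ) / ((p ^ 2 : ℕ) : ℝ) :=
          Nat.cast_div_le
        push_cast at hdiv
        calc ((B.filter fun f => (p : ℤ) ^ 2 ∣ f.disc ∧ ¬ (p : ℤ) ∣ f.discDerivE).card : ℝ)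
              ≤ ((3 * ((2 * T + 1) / p ^ 2 + 1) * (2 * T + 1) ^ 4 : ℕ) : ℝ) := by exact_mod_cast h1
          _ ≤ 3 * ((2 * (T : ℝ) + 1) / (p : ℝ) ^ 2 + 1) * (2 * (T : ℝ) + 1) ^ 4 := by
              push_cast
              gcongr
          _ = 3 * (2 * (T : ℝ) + 1) ^ 5 * (1 / (p : ℝ) ^ 2) + 3 * (2 * (T : ℝ) + 1) ^ 4 := by
              field_simp
    _ = 3 * (2 * (T : ℝ) + 1) ^ 5 * ∑ p ∈ Prm, 1 / (p : ℝ) ^ 2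
        + 3 * (2 * (T : ℝ) + 1) ^ 4 * Prm.card := by
        rw [sum_add_distrib, mul_sum, sum_const, nsmul_eq_mul]; ring
    _ ≤ 3 * (2 * (T : ℝ) + 1) ^ 5 * (1 / M) + 3 * (2 * (T : ℝ) + 1) ^ 4 * π T := by
        gcongr
        · exact sum_primes_Ioc_one_div_sq_le (by omega)
        · exact_mod_cast card_filter_prime_Ioc_le M T
    _ = 3 * (2 * (T : ℝ) + 1) ^ 5 / M + 3 * (2 * (T : ℝ) + 1) ^ 4 * π T := by ring

/-! ## §3. `p² ∣ Δ` for some prime `M < p ≤ T`: strong and weak divisibility together -/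

/-- **Uniformity estimate for `W_p = {p² ∣ Δ}` in a box, primes `M < p ≤ T`** (Bhargava–Shankar
2015, Thm 2.13 via Thms 2.18 and 2.20, the ranges not requiring [dodqf, Prop. 23]). For `T ≥ 3`,
`M ≥ 4` and a finite set `B` of integral binary quartic forms with coefficients in `[−T, T]`:
`#{f ∈ B : p² ∣ Δ(f) for some prime M < p ≤ T} ≤ (6144T⁵ + 3(2T+1)⁵)/M + 441(2T+1)⁴ + 3(2T+1)⁴·π(T)`
— a form with `p² ∣ Δ(f)` has either `p ∣ ∂Δ/∂e(f)` (then `f (mod p) ∈ Y = {Δ = ∂Δ/∂e = 0}`: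
geometric sieve, `card_filter_exists_prime_gt_dvd_disc_dvd_discDerivE_le`) or `p ∤ ∂Δ/∂e(f)` (weak
divisibility, `card_filter_exists_prime_Ioc_sq_dvd_disc_not_dvd_discDerivE_le`). With
`T ≍ X^{1/6}`, `π(T) ≪ T/log T` this is `O(X^{5/6}/M + X^{5/6}/log X)`; the remaining range
`p > X^{1/6}` of Thm 2.13 is the source's Thm 2.19 ([dodqf, Prop. 23]) with Prop. 2.16.
[cite: BhargavaShankarAnnals2015, §2.6, Thms 2.13, 2.18, 2.20 (published numbering)] -/
theorem card_filter_exists_prime_Ioc_sq_dvd_disc_le {T M : ℕ} (hT : 3 ≤ T) (hM : 4 ≤ M)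
    (B : Finset (BinaryQuartic ℤ))
    (hB : ∀ f ∈ B, |f.a| ≤ T ∧ |f.b| ≤ T ∧ |f.c| ≤ T ∧ |f.d| ≤ T ∧ |f.e| ≤ T) :
    ((B.filter fun f => ∃ p : ℕ, p.Prime ∧ M < p ∧ p ≤ T ∧ (p : ℤ) ^ 2 ∣ f.disc).card : ℝ)
      ≤ (6144 * (T : ℝ) ^ 5 + 3 * (2 * (T : ℝ) + 1) ^ 5) / M + 441 * (2 * (T : ℝ) + 1) ^ 4
        + 3 * (2 * (T : ℝ) + 1) ^ 4 * π T := by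
  classical
  have hsplit : (B.filter fun f => ∃ p : ℕ, p.Prime ∧ M < p ∧ p ≤ T ∧ (p : ℤ) ^ 2 ∣ f.disc)
      ⊆ (B.filter fun f => ∃ p : ℕ, p.Prime ∧ M < p ∧ (p : ℤ) ∣ f.disc ∧ (p : ℤ) ∣ f.discDerivE) ∪
        (B.filter fun f => ∃ p : ℕ, p.Prime ∧ M < p ∧ p ≤ T ∧
          (p : ℤ) ^ 2 ∣ f.disc ∧ ¬ (p : ℤ) ∣ f.discDerivE) := by
    intro f hf
    simp only [mem_filter] at hf
    obtain ⟨hfB, p, hp, hMp, hpT, h2⟩ := hf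
    simp only [mem_union, mem_filter]
    by_cases h : (p : ℤ) ∣ f.discDerivE
    · exact Or.inl ⟨hfB, p, hp, hMp, (dvd_pow_self (p : ℤ) two_ne_zero).trans h2, h⟩
    · exact Or.inr ⟨hfB, p, hp, hMp, hpT, h2, h⟩
  have hA := card_filter_exists_prime_gt_dvd_disc_dvd_discDerivE_le hT hM B hB
  have hW := card_filter_exists_prime_Ioc_sq_dvd_disc_not_dvd_discDerivE_le (T := T) hM B hB
  calc _ ≤ (((B.filter fun f => ∃ p : ℕ, p.Prime ∧ M < p ∧ (p : ℤ) ∣ f.disc ∧ (p : ℤ) ∣ f.discDerivE) ∪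
        (B.filter fun f => ∃ p : ℕ, p.Prime ∧ M < p ∧ p ≤ T ∧
          (p : ℤ) ^ 2 ∣ f.disc ∧ ¬ (p : ℤ) ∣ f.discDerivE)).card : ℝ) := by
        exact_mod_cast card_le_card hsplit
    _ ≤ ((B.filter fun f => ∃ p : ℕ, p.Prime ∧ M < p ∧ (p : ℤ) ∣ f.disc ∧ (p : ℤ) ∣ f.discDerivE).card : ℝ)
        + ((B.filter fun f => ∃ p : ℕ, p.Prime ∧ M < p ∧ p ≤ T ∧
          (p : ℤ) ^ 2 ∣ f.disc ∧ ¬ (p : ℤ) ∣ f.discDerivE).card : ℝ) := by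
        exact_mod_cast card_union_le _ _
    _ ≤ (6144 * (T : ℝ) ^ 5 / M + 441 * (2 * (T : ℝ) + 1) ^ 4)
        + (3 * (2 * (T : ℝ) + 1) ^ 5 / M + 3 * (2 * (T : ℝ) + 1) ^ 4 * π T) := add_le_add hA hW
    _ = _ := by ring

/-- **The same with Chebyshev's bound `π(T) ≤ (log 4)·T/log √T + √T`** (Mathlib,
`Chebyshev.pi_le_log4_mul_div`): for `T ≥ 3`, `M ≥ 4`,
`#{f ∈ B : p² ∣ Δ(f) for some prime M < p ≤ T}
 ≤ (6144T⁵ + 3(2T+1)⁵)/M + 441(2T+1)⁴ + 3(2T+1)⁴·((log 4)·T/log √T + √T)`, which is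
`O(T⁵/M + T⁵/log T)` — the shape `O(X^{5/6}/M + X^{5/6}/log X)` of Bhargava–Shankar 2015, proof of
Thm 2.13, for the primes up to `X^{1/6} ≍ T`. [cite: BhargavaShankarAnnals2015, §2.6, Thms 2.13, 2.18, 2.20 (published numbering)] -/
theorem card_filter_exists_prime_Ioc_sq_dvd_disc_le_chebyshev {T M : ℕ} (hT : 3 ≤ T) (hM : 4 ≤ M)
    (B : Finset (BinaryQuartic ℤ))
    (hB : ∀ f ∈ B, |f.a| ≤ T ∧ |f.b| ≤ T ∧ |f.c| ≤ T ∧ |f.d| ≤ T ∧ |f.e| ≤ T) :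
    ((B.filter fun f => ∃ p : ℕ, p.Prime ∧ M < p ∧ p ≤ T ∧ (p : ℤ) ^ 2 ∣ f.disc).card : ℝ)
      ≤ (6144 * (T : ℝ) ^ 5 + 3 * (2 * (T : ℝ) + 1) ^ 5) / M + 441 * (2 * (T : ℝ) + 1) ^ 4
        + 3 * (2 * (T : ℝ) + 1) ^ 4 * (Real.log 4 * T / Real.log (Real.sqrt T) + Real.sqrt T) := by
  have hπ : (π T : ℝ) ≤ Real.log 4 * T / Real.log (Real.sqrt T) + Real.sqrt T := by
    have h := Chebyshev.pi_le_log4_mul_div (x := (T : ℝ)) (by exact_mod_cast (by omega : 1 < T))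
    simpa only [Nat.floor_natCast] using h
  have h0 : (0 : ℝ) ≤ 3 * (2 * (T : ℝ) + 1) ^ 4 := by positivity
  calc _ ≤ _ := card_filter_exists_prime_Ioc_sq_dvd_disc_le hT hM B hB
    _ ≤ _ := by gcongr

/-! ## §4. An explicit form without `π(T)`: `≤ 6873·T⁵/M + 674·T⁵/log T + 35964·T⁴√T` -/

/-- **Explicit form** of `card_filter_exists_prime_Ioc_sq_dvd_disc_le_chebyshev` (`T ≥ 3`,
`M ≥ 4`): `#{f ∈ B : p² ∣ Δ(f) for some prime M < p ≤ T} ≤ 6873·T⁵/M + 674·T⁵/log T + 35964·T⁴·√T`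
(using `2T + 1 ≤ 3T`, `log √T = (log T)/2` and `log 4 < 674/486`). After division by `T⁵` this is
`6873/M + o(1)`, the shape `O(1/M) + o(1)` in which the uniformity estimate enters the square-free
sieve (Bhargava–Shankar 2015, proof of Thm 2.21: "`− O(1/log Y)`").
[cite: BhargavaShankarAnnals2015, §2.6–2.7, Thms 2.13 and 2.21 (published numbering)] -/
theorem card_filter_exists_prime_Ioc_sq_dvd_disc_le_explicit {T M : ℕ} (hT : 3 ≤ T) (hM : 4 ≤ M)
    (B : Finset (BinaryQuartic ℤ))
    (hB : ∀ f ∈ B, |f.a| ≤ T ∧ |f.b| ≤ T ∧ |f.c| ≤ T ∧ |f.d| ≤ T ∧ |f.e| ≤ T) :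
    ((B.filter fun f => ∃ p : ℕ, p.Prime ∧ M < p ∧ p ≤ T ∧ (p : ℤ) ^ 2 ∣ f.disc).card : ℝ)
      ≤ 6873 * (T : ℝ) ^ 5 / M + 674 * (T : ℝ) ^ 5 / Real.log T
        + 35964 * (T : ℝ) ^ 4 * Real.sqrt T := by
  have h := card_filter_exists_prime_Ioc_sq_dvd_disc_le_chebyshev hT hM B hB
  have hT3 : (3 : ℝ) ≤ T := by exact_mod_cast hT
  have hT0 : (0 : ℝ) < T := by linarith
  have hM0 : (0 : ℝ) < M := by exact_mod_cast (by omega : 0 < M)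
  have hlogT : 0 < Real.log T := Real.log_pos (by linarith)
  have hsqrt1 : (1 : ℝ) ≤ Real.sqrt T := by
    rw [show (1 : ℝ) = Real.sqrt 1 by simp]
    exact Real.sqrt_le_sqrt (by linarith)
  have hsqrt0 : (0 : ℝ) ≤ Real.sqrt T := Real.sqrt_nonneg _
  -- `2T + 1 ≤ 3T`
  have h21 : 2 * (T : ℝ) + 1 ≤ 3 * T := by linarith
  have h21_0 : (0 : ℝ) ≤ 2 * T + 1 := by linarith
  have h5 : (2 * (T : ℝ) + 1) ^ 5 ≤ 243 * (T : ℝ) ^ 5 := by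
    calc (2 * (T : ℝ) + 1) ^ 5 ≤ (3 * (T : ℝ)) ^ 5 := by gcongr
      _ = 243 * (T : ℝ) ^ 5 := by ring
  have h4 : (2 * (T : ℝ) + 1) ^ 4 ≤ 81 * (T : ℝ) ^ 4 := by
    calc (2 * (T : ℝ) + 1) ^ 4 ≤ (3 * (T : ℝ)) ^ 4 := by gcongr
      _ = 81 * (T : ℝ) ^ 4 := by ring
  -- `log √T = (log T)/2` and `log 4 < 674/486`
  have hlogsqrt : Real.log (Real.sqrt T) = Real.log T / 2 := by
    rw [Real.log_sqrt hT0.le]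
  have hlog4 : Real.log 4 ≤ 674 / 486 := by
    have : Real.log 4 = 2 * Real.log 2 := by
      rw [show (4 : ℝ) = 2 ^ 2 by norm_num, Real.log_pow]; norm_num
    rw [this]
    have := Real.log_two_lt_d9
    linarith
  have hlog4_0 : 0 ≤ Real.log 4 := Real.log_nonneg (by norm_num)
  -- the three terms
  have t1 : (6144 * (T : ℝ) ^ 5 + 3 * (2 * (T : ℝ) + 1) ^ 5) / M ≤ 6873 * (T : ℝ) ^ 5 / M := by
    rw [div_le_div_iff_of_pos_right hM0]
    linarith
  have t2 : 441 * (2 * (T : ℝ) + 1) ^ 4 ≤ 35721 * (T : ℝ) ^ 4 * Real.sqrt T := by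
    calc 441 * (2 * (T : ℝ) + 1) ^ 4 ≤ 441 * (81 * (T : ℝ) ^ 4) * 1 := by rw [mul_one]; gcongr
      _ ≤ 441 * (81 * (T : ℝ) ^ 4) * Real.sqrt T := by gcongr
      _ = 35721 * (T : ℝ) ^ 4 * Real.sqrt T := by ring
  have t3 : 3 * (2 * (T : ℝ) + 1) ^ 4 * (Real.log 4 * T / Real.log (Real.sqrt T) + Real.sqrt T)
      ≤ 674 * (T : ℝ) ^ 5 / Real.log T + 243 * (T : ℝ) ^ 4 * Real.sqrt T := by
    rw [hlogsqrt]
    have hA : Real.log 4 * T / (Real.log T / 2) = 2 * Real.log 4 * T / Real.log T := by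
      field_simp
    rw [hA]
    have hB : 0 ≤ 2 * Real.log 4 * T / Real.log T := by positivity
    calc 3 * (2 * (T : ℝ) + 1) ^ 4 * (2 * Real.log 4 * T / Real.log T + Real.sqrt T)
          ≤ 3 * (81 * (T : ℝ) ^ 4) * (2 * Real.log 4 * T / Real.log T + Real.sqrt T) := by gcongr
      _ = 243 * (T : ℝ) ^ 4 * (2 * Real.log 4) * T / Real.log T + 243 * (T : ℝ) ^ 4 * Real.sqrt T := by
          ring
      _ ≤ 243 * (T : ℝ) ^ 4 * (2 * (674 / 486)) * T / Real.log T + 243 * (T : ℝ) ^ 4 * Real.sqrt T := by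
          gcongr
      _ = 674 * (T : ℝ) ^ 5 / Real.log T + 243 * (T : ℝ) ^ 4 * Real.sqrt T := by ring
  linarith

end BinaryQuartic

end Literature.NumberTheory.EllipticCurves

end
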